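import Summits.BirchSwinnertonDyer.BirchSwinnertonDyer.Theses.QuadraticBranchSignedControl
import Summits.BirchSwinnertonDyer.BirchSwinnertonDyer.Theorems.QuadraticBranchSignedControlEtaLayerComparison
import Summits.BirchSwinnertonDyer.BirchSwinnertonDyer.Theorems.QuadraticBranchSignedControlEtaTransportSelmerMapOfLayers
import Summits.BirchSwinnertonDyer.BirchSwinnertonDyer.Theorems.QuadraticBranchSignedControlEtaTransportSelmerComparisonOfMap
import Summits.BirchSwinnertonDyer.BirchSwinnertonDyer.Theorems.QuadraticBranchSignedControlEtaTransportDecompositionOfFrames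
import Summits.BirchSwinnertonDyer.BirchSwinnertonDyer.Theorems.QuadraticBranchSignedControlEtaTransportDecompositionOfFrameA
import Summits.BirchSwinnertonDyer.BirchSwinnertonDyer.Theorems.QuadraticBranchSignedControlEtaFrameModelChange
import HarnessLib

/-!
# Route `QuadraticBranchSignedControl` (rung K8, cell `bsd-potss`): the ∀-form prime-to-`p`
# DESCENT FRAME `EtaDescentFrame` (item stmt-BirchSwinnertonDyer-19611) — PROVED, unconditionally

WHAT. The shared frame of the K8 even-main-conjecture block (items 19611 `EtaDescentFrame` ⊇ 19602
`EtaDescentFrameSurj`, 19607 `EtaDescentFrameNonsurj`; the hypothesis `hdec`/`hdecA` of seat k8q-c2's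
transports p422507 / p428136 / p429727 / p435617 and of the glue items 19605 / 19609 / 19614): for
`p ≥ 5`, `K₀ ⊇ ℚ(ζ_p)` with an even non-trivial sign character `ηq`, every good `a_p = 0` curve
`V/ℚ`, every cyclotomic `(κ, γ)` (`γ ∈ Gal(ℚ̄/K₀)`, `γ ↔ 1 + X`) and EVERY admissible quadratic model
— `F` quadratic with `θ_F² = p*`, `V' = C • V_F`, `κF` cyclotomic, `γF` a top generator of `κF` with
`χ(γF)·ζ = 1 + p` — a `Γ`-equivariant decomposition
`Φ : Sel⁺(V'/F_∞) ≃+ Sel⁺(V/ℚ_∞) × Sel⁺(V/K₀ℚ_∞)^η` intertwining `conj_{γF}` with `conj_γ`.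

HOW (this seat's contribution = ADMISSIBLE-MODEL INDEPENDENCE on top of seat k8q-c3's chain).
* §1 (characters) The ζ-clause for `γF`, `γ ↔ 1 + X` and `ker κ = χ⁻¹(μ)` force
  `γ⁻¹·γF|_{ℚ̄} ∈ ker κ` (`inv_mul_resGal_mem_kerSubgroup_of_zeta`); hence a cyclotomic `κF` with top
  generator `γF` IS the restricted tower `κ|_{Γ_F}` ON THE NOSE (`eq_restrictGal_of_isTopGenerator`:
  `κF = (κ|_{Γ_F})·u` by uniqueness up to `ℤ_pˣ`, and `u = κF(γF)/κ(γF|) = 1`).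
* §2 (model) `Sel⁺(C • V_F / F_∞) ≃+ Sel⁺(V_F/F_∞)` `Γ_F`-equivariantly (this seat's
  `EtaFrame.exists_addEquiv_signedSelmerInfty_of_model`, file `…EtaFrameModelChange`).
* §3 (assembly at ONE model, k8q-c3's `etaDecomposition_of_frames` made pointwise) from
  `ΨA : Sel⁺(V'/F_∞) ≃+ Sel⁺_tower(V/Fℚ_∞)` and the landed bricks (B1) tower decomposition, (B2⁰)
  `η = 1` transfer, (B3) two fields, (i-f) local model at `p`, (U) the sign character.
* §4 `ΨA` itself is k8q-c3's PROVED comparison `selmerComparison_of_map_eq (selmerMap_of_layerMaps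
  etaLayerComparison_proof)` (items 19583/19585) at `(V_F, κ|_{Γ_F}, γF)`, composed with §2; then
  `etaDescentFrame_proof : EtaDescentFrame`.

HONEST FRAMING (cell `bsd-potss`, run/shared/lean/pub/bsd-potss/; FULL-BSD rank ≤ 1 programme):
THEOREMS ONLY (no definition, no named fact, no `sorry`, axioms standard), UNCONDITIONAL. This closes
the SUPPORT item 19611 (and, by restriction, 19602 / 19607 in sibling files); it proves NO main
conjecture: the cruxes 19601 / 19606, the readings 19241 and the held Kobayashi facts are untouched;
`BSD(W, p)` is claimed for no pair. Seat `bsd-potss-k8eta-c2` (prover), g0;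
`--workitem stmt-BirchSwinnertonDyer-19611`.

References: [Kobayashi2003] Def. 1.1 (p. 2), Def. 2.1 (p. 5), §3 p. 5 (`γ ↔ 1 + X`, `G_∞ = Δ × Γ`),
§4 p. 8 (`X(E/K_∞)^η`); [GreenbergLNM1716] §3 (descent in prime-to-`p` extensions); [Washington1997]
§13.1 (uniqueness of the cyclotomic `ℤ_p`-extension up to `ℤ_pˣ`).
-/

set_option autoImplicit false
set_option linter.dupNamespace false

noncomputable section

open scoped Classical

open Field WeierstrassCurve NumberField IsDedekindDomain
open Literature.NumberTheory.EllipticCurves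
open Literature.NumberTheory.GaloisRepresentations
open Summit.BirchSwinnertonDyer.Rank1Residual.Additive
open Summit.BirchSwinnertonDyer.Rank1Residual.Additive.SignedTwist
open Summit.BirchSwinnertonDyer.Rank1Residual.AdditivePotMult

namespace Summit.BirchSwinnertonDyer.BirchSwinnertonDyer.Theorems

/-! ## §1 Characters: the ζ-clauses pin `γF|_{ℚ̄}` modulo `ker κ` and `κF = κ|_{Γ_F}` -/

section Characters

variable {p : ℕ} [Fact p.Prime] {κ : ZpExtension ℚ p} (F : Type) [Field F] [NumberField F]

/-- **`γ⁻¹ · γF|_{ℚ̄} ∈ ker κ`** for the cyclotomic `κ`: if `χ(γ)·ζ' = 1 + p` (`γ ↔ 1 + X`,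
`IsCyclotomicVariable`) and `χ_F(γF)·ζ = 1 + p` with `ζ, ζ'` of finite order, then
`χ(γ⁻¹·γF|_{ℚ̄}) = ζ'·ζ⁻¹` is torsion (`χ_F = χ ∘ res`), i.e. lies in `ker κ = χ⁻¹(μ(ℤ_p))`.
[cite: Kobayashi2003, §3 p. 5 (γ ↔ 1 + X)] [cite: Washington1997, §13.1] -/
theorem inv_mul_resGal_mem_kerSubgroup_of_zeta (hκ : κ.IsCyclotomic) {γ : absoluteGaloisGroup ℚ}
    (hγc : IsCyclotomicVariable p γ) {γF : absoluteGaloisGroup F}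
    (hζ : ∃ ζ : ℤ_[p]ˣ, IsOfFinOrder ζ ∧
      ((GaloisRep.cyclotomicCharacter F p γF * ζ : ℤ_[p]ˣ) : ℤ_[p]) = (cyclotomicGenerator p : ℤ_[p])) :
    γ⁻¹ * resGal (K := ℚ) F γF ∈ κ.kerSubgroup := by
  haveI : NeZero (p : ℚ) := ⟨by exact_mod_cast (Fact.out : p.Prime).ne_zero⟩
  obtain ⟨ζ', hζ', hγ⟩ := hγc
  obtain ⟨ζ, hζ, hγF⟩ := hζ
  rw [← cyclotomicCharacter_absGaloisRestrict ℚ F p γF, ← WeierstrassCurve.resGal_eq_absGaloisRestrict]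
    at hγF
  have hu : GaloisRep.cyclotomicCharacter ℚ p (resGal (K := ℚ) F γF) * ζ =
      GaloisRep.cyclotomicCharacter ℚ p γ * ζ' := Units.ext (hγF.trans hγ.symm)
  have hχ : GaloisRep.cyclotomicCharacter ℚ p (γ⁻¹ * resGal (K := ℚ) F γF) = ζ' * ζ⁻¹ := by
    rw [map_mul, map_inv, eq_mul_inv_iff_mul_eq, mul_assoc, hu, inv_mul_cancel_left]
  rw [ZpExtension.IsCyclotomic] at hκ
  rw [hκ, Subgroup.mem_comap]
  change GaloisRep.cyclotomicCharacter ℚ p (γ⁻¹ * resGal (K := ℚ) F γF) ∈ CommGroup.torsion ℤ_[p]ˣ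
  rw [hχ]
  exact mul_mem ((CommGroup.mem_torsion _).mpr hζ') (inv_mem ((CommGroup.mem_torsion _).mpr hζ))

/-- **A cyclotomic `κF` over `F` with a top generator `γF` satisfying the ζ-clause IS `κ|_{Γ_F}`.**
`κF` and `κ|_{Γ_F}` are both cyclotomic, so `κF = (κ|_{Γ_F})·u` for a unit `u` (uniqueness of the
cyclotomic `ℤ_p`-extension up to `ℤ_pˣ`, tree `IsCyclotomic.exists_eq_unitTwist_holds`); evaluating
at `γF`: `1 = κF(γF) = u·κ(γF|_{ℚ̄}) = u·κ(γ) = u`. [cite: Washington1997, §13.1]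
[cite: Kobayashi2003, §3 p. 5] -/
theorem eq_restrictGal_of_isTopGenerator (hκ : κ.IsCyclotomic)
    (hκ₀ : ∀ x, ∃ g ∈ galRange (K := ℚ) F, κ g = x) {γ : absoluteGaloisGroup ℚ}
    (hγ : κ.IsTopGenerator γ) {κF : ZpExtension F p} (hκF : κF.IsCyclotomic)
    {γF : absoluteGaloisGroup F} (hγF : κF.IsTopGenerator γF)
    (hδ : γ⁻¹ * resGal (K := ℚ) F γF ∈ κ.kerSubgroup) :
    κF = BaseChange.restrictGal F κ hκ₀ := by
  obtain ⟨u, hu⟩ := ZpExtension.IsCyclotomic.exists_eq_unitTwist_holds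
    (BaseChange.isCyclotomic_restrictGal F κ hκ₀ hκ) hκF
  have hκγF : κ (resGal (K := ℚ) F γF) = Multiplicative.ofAdd 1 := by
    have h : κ (resGal (K := ℚ) F γF) = κ γ * κ (γ⁻¹ * resGal (K := ℚ) F γF) := by
      rw [← map_mul, mul_inv_cancel_left]
    rw [h, ZpExtension.mem_kerSubgroup.mp hδ, mul_one]
    exact hγ
  have h1 : (u : ℤ_[p]) = 1 := by
    have h := hγF
    rw [ZpExtension.IsTopGenerator, hu, ZpExtension.unitTwist_apply, BaseChange.restrictGal_apply,
      hκγF, toAdd_ofAdd, mul_one] at h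
    exact Multiplicative.ofAdd.injective h
  rw [hu]
  apply ZpExtension.toContinuousMonoidHom_injective
  ext σ : 1
  change (BaseChange.restrictGal F κ hκ₀).unitTwist u σ = BaseChange.restrictGal F κ hκ₀ σ
  rw [ZpExtension.unitTwist_apply, h1, one_mul, ofAdd_toAdd]

end Characters

/-! ## §2–3 The decomposition at ONE admissible model (k8q-c3's assembly, pointwise) -/

/-- **The decomposition frame at a given admissible model.** Data: `p` odd, `K₀ ⊇ ℚ(ζ_p)` with the
even non-trivial sign character `ηq`, `V/ℚ`, a cyclotomic `κ` with `γ ∈ Gal(ℚ̄/K₀)`, a quadratic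
`F ∋ θ_F` (`θ_F² = p*`, `θ_F ∉ ℚ`, `Gal(ℚ̄/F)` normal), a model `V'/F`, a `ℤ_p`-extension `κF` of `F`
with `γF`, `γ⁻¹·γF|_{ℚ̄} ∈ ker κ`, and a comparison `ΨA : Sel⁺(V'/F_∞) ≃+ Sel⁺_tower(V/Fℚ_∞)`
intertwining `conj_{γF}` with `conj_{γF|}`. Conclusion: a decomposition
`Φ : Sel⁺(V'/F_∞) ≃+ Sel⁺(V/ℚ_∞) × Sel⁺(V/K₀ℚ_∞)^η` intertwining `conj_{γF}` with `conj_γ` — seat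
k8q-c3's `etaDecomposition_of_frames` (p424958) with the model GIVEN instead of produced: bricks (B1)
`exists_addEquiv_prod_towerSignedSelmerInftyEta`, (B2⁰) `exists_addEquiv_strictSignedSelmerInfty_towerEta_one`,
(B3) `exists_addEquiv_towerSignedSelmerInftyEta_of_two_fields`, (i-f)
`signedSelmerInfty_one_eq_strictSignedSelmerInfty_padic`, (U) the sign-character calculus.
[cite: Kobayashi2003, §4 p. 8 (X(E/K_∞)^η; M = ⊕ M^η), Def. 1.1 (p. 2), Def. 2.1 (p. 5)]
[cite: GreenbergLNM1716, §3] -/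
theorem etaDecomposition_of_model (p : ℕ) [Fact p.Prime] (hp2 : p ≠ 2)
    (K₀ : Type) [Field K₀] [NumberField K₀] [IsCyclotomicExtension {p} ℚ K₀]
    [(galRange (K := ℚ) K₀).Normal] (ηq : absoluteGaloisGroup ℚ →* ℤˣ)
    (hηK : ∀ σ ∈ galRange (K := ℚ) K₀, ηq σ = 1) (hη1 : ηq ≠ 1)
    (V : WeierstrassCurve ℚ) [V.IsElliptic] (κ : ZpExtension ℚ p) (γ : absoluteGaloisGroup ℚ)
    (hκ : κ.IsCyclotomic) (hγK : γ ∈ galRange (K := ℚ) K₀)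
    (F : Type) [Field F] [NumberField F] [(galRange (K := ℚ) F).Normal] (θF : F)
    (V' : WeierstrassCurve F) (κF : ZpExtension F p) (γF : absoluteGaloisGroup F)
    (ΨA : Kobayashi2003.signedSelmerInfty V' κF 1 ≃+ towerSignedSelmerInfty V κ F ℚ_[p] 1)
    (h2 : Module.finrank ℚ F = 2) (hθF : θF ∉ Set.range (algebraMap ℚ F))
    (hcF : θF ^ 2 = algebraMap ℚ F ((-1) ^ (p / 2) * p))
    (hδ : γ⁻¹ * resGal (K := ℚ) F γF ∈ κ.kerSubgroup)
    (hΨA : ∀ s : Kobayashi2003.signedSelmerInfty V' κF 1,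
      ((ΨA ⟨V'.conjH1 p κF.kerSubgroup γF s,
          Kobayashi2003.conjH1_mem_signedSelmerInfty V' κF 1 γF s.2⟩ :
          towerSignedSelmerInfty V κ F ℚ_[p] 1) : V.subgroupH1 p (towerTopSubgroup κ F)) =
        V.conjH1 p (towerTopSubgroup κ F) (resGal (K := ℚ) F γF) (ΨA s)) :
    ∃ Φ : Kobayashi2003.signedSelmerInfty V' κF 1 ≃+
        Kobayashi2003.signedSelmerInfty V κ 1 × towerSignedSelmerInftyEta V κ K₀ ℚ_[p] ηq 1,
      ∀ s : Kobayashi2003.signedSelmerInfty V' κF 1,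
        ((Φ ⟨V'.conjH1 p κF.kerSubgroup γF s,
            Kobayashi2003.conjH1_mem_signedSelmerInfty V' κF 1 γF s.2⟩).1 : V.subgroupH1 p κ.kerSubgroup) =
          V.conjH1 p κ.kerSubgroup γ (Φ s).1 ∧
        ((Φ ⟨V'.conjH1 p κF.kerSubgroup γF s,
            Kobayashi2003.conjH1_mem_signedSelmerInfty V' κF 1 γF s.2⟩).2 :
            V.subgroupH1 p (towerTopSubgroup κ K₀)) =
          V.conjH1 p (towerTopSubgroup κ K₀) γ (Φ s).2 := by
  -- adapted from seat k8q-c3's `etaDecomposition_of_frames` (…EtaTransportDecompositionOfFrames.lean)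
  have hpP : p.Prime := Fact.out
  -- `√p* ∈ K₀` (Gauss) and the sign-character binders at `K₀` and at `F`
  have hc0 : ((-1 : ℚ) ^ (p / 2) * p) ≠ 0 :=
    mul_ne_zero (pow_ne_zero _ (by norm_num)) (Nat.cast_ne_zero.mpr hpP.ne_zero)
  obtain ⟨θ₀, hθ₀2⟩ := exists_sq_eq_pStar p K₀ hp2
  have hc₀ : θ₀ ^ 2 = algebraMap ℚ K₀ ((-1) ^ (p / 2) * p) := by
    rw [hθ₀2, map_mul, map_pow, map_neg, map_one, map_natCast]
  have hθ₀ : θ₀ ∉ Set.range (algebraMap ℚ K₀) := by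
    rintro ⟨q, hq⟩
    apply forall_sq_ne_pStar p q
    apply (algebraMap ℚ K₀).injective
    rw [map_pow, hq, hc₀]
  have hηK₀ : ∀ σ, ηq σ = 1 ↔ σ • rootInClosure K₀ θ₀ = rootInClosure K₀ θ₀ :=
    eta_eq_one_iff_smul_rootInClosure p K₀ hθ₀ hc₀ ηq hηK hη1
  have hηF : ∀ σ, ηq σ = 1 ↔ σ • rootInClosure F θF = rootInClosure F θF :=
    eta_eq_one_iff_smul_rootInClosure_of_sq_eq p K₀ ηq F hηK hη1 hcF hθ₀ hc₀
  have hFη : ∀ σ, σ ∈ galRange (K := ℚ) F ↔ ηq σ = 1 :=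
    mem_galRange_iff_eta_eq_one p K₀ ηq F h2 hθF hcF hηK hη1 hθ₀ hc₀
  -- the (P5) binders at `K₀` and at `F`
  have hDK := localTowerHyp_padic p κ K₀ hκ
  have hDF := localTowerHyp_padic_of_sq_eq p K₀ ηq F κ hκ h2 hθF hcF hηK hη1 hθ₀ hc₀
  have hκK : ∀ x, ∃ g ∈ galRange (K := ℚ) K₀, κ g = x := kappa_surjOn_galRange_cyclotomic κ K₀
  haveI : IsGalois ℚ F := isGalois_of_finrank_eq_two F h2
  have hcopF' : p.Coprime (Module.finrank ℚ F) := by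
    rw [h2]; exact (Nat.coprime_primes hpP Nat.prime_two).mpr hp2
  have hκF' : ∀ x, ∃ g ∈ galRange (K := ℚ) F, κ g = x :=
    kappa_surjOn_galRange_of_coprime_finrank κ F hcopF'
  have hcopK : (galRange (K := ℚ) K₀).index.Coprime p := coprime_index_galRange_cyclotomic p K₀
  have hcopF : (galRange (K := ℚ) F).index.Coprime p := by
    rw [RelModel.index_galRange (K := ℚ) F, h2]
    exact (Nat.coprime_primes Nat.prime_two hpP).mpr hp2.symm
  -- the twist partner `W = V^{(p*)}`
  obtain ⟨C, hCV⟩ := exists_variableChange_twist_twist V hc0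
  have hCW : (1 : VariableChange ℚ) • V.quadraticTwist ((-1) ^ (p / 2) * p) =
      V.quadraticTwist ((-1) ^ (p / 2) * p) := one_smul _ _
  -- (B1) at `F`
  have hηker : ∀ σ ∈ κ.kerSubgroup, ηq σ = 1 → σ ∈ galRange (K := ℚ) F :=
    fun σ _ h => (hFη σ).mpr h
  have hτ := exists_mem_kerSubgroup_eta_ne_one p K₀ ηq F κ hp2 h2 hθF hcF hηK hη1 hθ₀ hc₀
  obtain ⟨Ψ₁, hΨ₁⟩ :=
    exists_addEquiv_prod_towerSignedSelmerInftyEta V κ F ηq ℚ_[p] 1 hp2 hηker hτ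
  -- (B2⁰) at `F` and (i-f)
  obtain ⟨Ψ₂, hΨ₂⟩ := exists_addEquiv_strictSignedSelmerInfty_towerEta_one
    (V.quadraticTwist ((-1) ^ (p / 2) * p)) p κ ℚ_[p] ηq F hθF hcF hCV hCW hηF hDF hκF' hcopF
  have hS₀ : Kobayashi2003.signedSelmerInfty V κ 1 = strictSignedSelmerInfty V κ ℚ_[p] 1 :=
    signedSelmerInfty_one_eq_strictSignedSelmerInfty_padic V κ
  obtain ⟨e₀, he₀⟩ : ∃ e : Kobayashi2003.signedSelmerInfty V κ 1 ≃+ strictSignedSelmerInfty V κ ℚ_[p] 1,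
      ∀ z, ((e.symm z : Kobayashi2003.signedSelmerInfty V κ 1) : V.subgroupH1 p κ.kerSubgroup) = z :=
    ⟨AddEquiv.addSubgroupCongr hS₀, fun z => AddEquiv.addSubgroupCongr_symm_apply hS₀ z⟩
  -- (B3) at `(F, K₀)`
  obtain ⟨Ψ₃, hΨ₃⟩ := exists_addEquiv_towerSignedSelmerInftyEta_of_two_fields
    (V.quadraticTwist ((-1) ^ (p / 2) * p)) p κ ℚ_[p] ηq F K₀ hθF hcF hθ₀ hc₀ hCV hηF hηK₀
    hDF hDK hκF' hκK hcopF hcopK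
  -- the decomposition
  obtain ⟨Φ, hΦ⟩ : ∃ Φ : Kobayashi2003.signedSelmerInfty V' κF 1 ≃+
      Kobayashi2003.signedSelmerInfty V κ 1 × towerSignedSelmerInftyEta V κ K₀ ℚ_[p] ηq 1,
      ∀ x, Φ x = (e₀.symm (Ψ₂.symm (Ψ₁.symm (ΨA x)).1), Ψ₃ (Ψ₁.symm (ΨA x)).2) :=
    ⟨ΨA.trans (Ψ₁.symm.trans (AddEquiv.prodCongr (Ψ₂.symm.trans e₀.symm) Ψ₃)), fun x => by
      rw [addEquiv_trans_symm_trans_prodCongr_apply, AddEquiv.trans_apply]⟩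
  refine ⟨Φ, fun s => ?_⟩
  -- `conj_{g'} = conj_γ` on the two targets, `g' = γF|_{ℚ̄}`, `γ⁻¹ g' ∈ ker κ ∩ ker ηq`
  set g' := resGal (K := ℚ) F γF with hg'
  have hg'F : g' ∈ galRange (K := ℚ) F := (mem_galRange_iff F g').mpr ⟨γF, rfl⟩
  have hηδ : ((ηq (γ⁻¹ * g') : ℤˣ) : ℤ) = 1 := by
    rw [map_mul, map_inv, hηK γ hγK, (hFη g').mp hg'F, inv_one, one_mul, Units.val_one]
  have hgg : g' = γ * (γ⁻¹ * g') := by rw [mul_inv_cancel_left]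
  have hconj₀ : ∀ x : V.subgroupH1 p κ.kerSubgroup,
      V.conjH1 p κ.kerSubgroup g' x = V.conjH1 p κ.kerSubgroup γ x := fun x => by
    rw [hgg, V.conjH1_mul_holds p κ.kerSubgroup, AddMonoidHom.comp_apply,
      V.conjH1_of_mem_holds p κ.kerSubgroup hδ, AddMonoidHom.id_apply]
  have hconjη : ∀ y : towerSignedSelmerInftyEta V κ K₀ ℚ_[p] ηq 1,
      V.conjH1 p (towerTopSubgroup κ K₀) g' (y : V.subgroupH1 p (towerTopSubgroup κ K₀)) =
        V.conjH1 p (towerTopSubgroup κ K₀) γ y := fun y => by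
    rw [hgg, V.conjH1_mul_holds p (towerTopSubgroup κ K₀), AddMonoidHom.comp_apply,
      ((mem_towerSignedSelmerInftyEta_iff V κ K₀ ℚ_[p] ηq 1 _).mp y.2).2 _ hδ, hηδ, one_zsmul]
  -- `Ψ_A` and `Ψ₁⁻¹` on `conj`
  have step1 : ΨA ⟨V'.conjH1 p κF.kerSubgroup γF s, Kobayashi2003.conjH1_mem_signedSelmerInfty V' κF 1 γF s.2⟩ =
      ⟨V.conjH1 p (towerTopSubgroup κ F) g' (ΨA s),
        conjH1_mem_towerSignedSelmerInfty V κ F ℚ_[p] 1 g' (ΨA s).2⟩ :=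
    Subtype.ext (hΨA s)
  have step2 := addEquiv_prod_towerSignedSelmerInftyEta_symm_conjH1 V κ F ηq ℚ_[p] 1 Ψ₁ hΨ₁ g' (ΨA s)
  -- `Ψ₂⁻¹` on `conj`
  have step3 : ∀ a : towerSignedSelmerInftyEta V κ F ℚ_[p] 1 1,
      ((Ψ₂.symm ⟨V.conjH1 p (towerTopSubgroup κ F) g' (a : V.subgroupH1 p (towerTopSubgroup κ F)),
          conjH1_mem_towerSignedSelmerInftyEta V κ F ℚ_[p] 1 1 g' a.2⟩ :
          strictSignedSelmerInfty V κ ℚ_[p] 1) : V.subgroupH1 p κ.kerSubgroup) =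
        V.conjH1 p κ.kerSubgroup g' (Ψ₂.symm a : strictSignedSelmerInfty V κ ℚ_[p] 1) := by
    intro a
    have h := hΨ₂ g' (Ψ₂.symm a)
    rw [AddEquiv.apply_symm_apply] at h
    have h' : Ψ₂ ⟨V.conjH1 p κ.kerSubgroup g' (Ψ₂.symm a : strictSignedSelmerInfty V κ ℚ_[p] 1),
        conjH1_mem_strictSignedSelmerInfty V κ ℚ_[p] 1 g' (Ψ₂.symm a).2⟩ =
        ⟨V.conjH1 p (towerTopSubgroup κ F) g' (a : V.subgroupH1 p (towerTopSubgroup κ F)),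
          conjH1_mem_towerSignedSelmerInftyEta V κ F ℚ_[p] 1 1 g' a.2⟩ := Subtype.ext h
    rw [← h', AddEquiv.symm_apply_apply]
  refine ⟨?_, ?_⟩
  · rw [hΦ, hΦ, step1, step2, he₀, he₀, step3, hconj₀]
  · rw [hΦ, hΦ, step1, step2]
    change ((Ψ₃ ⟨V.conjH1 p (towerTopSubgroup κ F) g' ((Ψ₁.symm (ΨA s)).2 : V.subgroupH1 p (towerTopSubgroup κ F)),
        conjH1_mem_towerSignedSelmerInftyEta V κ F ℚ_[p] ηq 1 g' (Ψ₁.symm (ΨA s)).2.2⟩ :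
        towerSignedSelmerInftyEta V κ K₀ ℚ_[p] ηq 1) : V.subgroupH1 p (towerTopSubgroup κ K₀)) =
      V.conjH1 p (towerTopSubgroup κ K₀) γ (Ψ₃ (Ψ₁.symm (ΨA s)).2)
    rw [hΨ₃, hconjη]

/-! ## §4 The ∀-form descent frame -/

/-- **Item stmt-BirchSwinnertonDyer-19611 `EtaDescentFrame` — PROVED.** For `p ≥ 5`, `K₀ ⊇ ℚ(ζ_p)`
with an even non-trivial sign character `ηq`, every good supersingular `a_p = 0` curve `V/ℚ`, every
cyclotomic `(κ, γ)` with `γ ∈ Gal(ℚ̄/K₀)` and `γ ↔ 1 + X`, and EVERY admissible quadratic model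
`(F, V' = C • V_F, κF, γF)`: a decomposition `Φ : Sel⁺(V'/F_∞) ≃+ Sel⁺(V/ℚ_∞) × Sel⁺(V/K₀ℚ_∞)^η`
intertwining `conj_{γF}` with `conj_γ`. Proof: `Gal(ℚ̄/F)` is normal (`F/ℚ` quadratic), `κ` is onto
on it (`p ∤ 2`); §1 gives `γ⁻¹·γF| ∈ ker κ` and `κF = κ|_{Γ_F}`; seat k8q-c3's PROVED comparison
(`etaLayerComparison_proof` ∘ `selmerMap_of_layerMaps` ∘ `selmerComparison_of_map_eq`, items
19583/19585) gives `ΨA` for `V_F`, the model-change isomorphism (`EtaFrame.exists_addEquiv_signedSelmerInfty_of_model`)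
moves it to `V'`, and `etaDecomposition_of_model` assembles `Φ`. UNCONDITIONAL; closes the support
item only (no main conjecture is touched). [cite: Kobayashi2003, Def. 1.1 (p. 2), Def. 2.1 (p. 5), §3 p. 5, §4 p. 8]
[cite: GreenbergLNM1716, §3] [cite: Washington1997, §13.1] -/
theorem etaDescentFrame_proof :
    Summit.BirchSwinnertonDyer.BirchSwinnertonDyer.Theses.QuadraticBranchSignedControl.EtaDescentFrame := by
  unfold Theses.QuadraticBranchSignedControl.EtaDescentFrame
  intro p _ hp5 K₀ _ _ _ _ ηq hηK hη1 V _ _ hgood hap κ γ hκ hγ hγK hγc F _ _ V' _ κF γF h2 hθ hCV'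
    hκF hγF hζ
  have hpP : p.Prime := Fact.out
  have hp2 : p ≠ 2 := by omega
  obtain ⟨θF, hcF⟩ := hθ
  have hθF : θF ∉ Set.range (algebraMap ℚ F) := by
    rintro ⟨q, hq⟩
    apply forall_sq_ne_pStar p q
    apply (algebraMap ℚ F).injective
    rw [map_pow, hq, hcF]
  haveI : IsGalois ℚ F := isGalois_of_finrank_eq_two F h2
  haveI hN : (galRange (K := ℚ) F).Normal := RelModel.normal_galRange (K := ℚ) F
  have hcop : p.Coprime (Module.finrank ℚ F) := by
    rw [h2]; exact (Nat.coprime_primes hpP Nat.prime_two).mpr hp2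
  have hκ₀ : ∀ x, ∃ g ∈ galRange (K := ℚ) F, κ g = x :=
    kappa_surjOn_galRange_of_coprime_finrank κ F hcop
  -- §1: `γ⁻¹·γF| ∈ ker κ` and `κF = κ|_{Γ_F}`
  have hδ : γ⁻¹ * resGal (K := ℚ) F γF ∈ κ.kerSubgroup :=
    inv_mul_resGal_mem_kerSubgroup_of_zeta F hκ hγc hζ
  obtain rfl : κF = BaseChange.restrictGal F κ hκ₀ :=
    eq_restrictGal_of_isTopGenerator F hκ hκ₀ hγ hκF hγF hδ
  -- k8q-c3's comparison at `(V_F, κ|_{Γ_F}, γF)`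
  obtain ⟨ΨA₀, hΨA₀⟩ := selmerComparison_of_map_eq
    (selmerMap_of_layerMaps (by
      have hL := etaLayerComparison_proof
      unfold Theses.QuadraticBranchSignedControl.EtaLayerComparison at hL
      exact hL))
    p hp5 V hgood hap κ hκ F θF h2 hθF hcF hκ₀ γF hγF
  -- §2: the model change `V' = C • V_F`
  obtain ⟨C, hC⟩ := hCV'
  obtain ⟨ΨC, -, hΨC⟩ := EtaFrame.exists_addEquiv_signedSelmerInfty_of_model p hC
    (BaseChange.restrictGal F κ hκ₀) 1
  -- §3: assemble
  refine etaDecomposition_of_model p hp2 K₀ ηq hηK hη1 V κ γ hκ hγK F θF V'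
    (BaseChange.restrictGal F κ hκ₀) γF (ΨC.trans ΨA₀) h2 hθF hcF hδ fun s => ?_
  rw [AddEquiv.trans_apply, AddEquiv.trans_apply]
  have h1 : ΨC ⟨V'.conjH1 p (BaseChange.restrictGal F κ hκ₀).kerSubgroup γF s,
      Kobayashi2003.conjH1_mem_signedSelmerInfty V' _ 1 γF s.2⟩ =
      ⟨(V.baseChange F).conjH1 p (BaseChange.restrictGal F κ hκ₀).kerSubgroup γF (ΨC s),
        Kobayashi2003.conjH1_mem_signedSelmerInfty (V.baseChange F) _ 1 γF (ΨC s).2⟩ :=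
    Subtype.ext (hΨC γF s)
  rw [h1]
  exact hΨA₀ (ΨC s)

end Summit.BirchSwinnertonDyer.BirchSwinnertonDyer.Theorems

end
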